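import Summits.BirchSwinnertonDyer.BirchSwinnertonDyer.Theorems.GenusKolyvaginAtTwoGenusPrimitiveSupplyAtTwoPosDiscShallowStubCSplit
import Summits.BirchSwinnertonDyer.BirchSwinnertonDyer.Theorems.GenusKolyvaginAtTwoPowDvdShaCardAtTwoRTKolyvaginMinima
import HarnessLib

/-!
# Disproof of `GenusPrimitiveSupplyAtTwoPosDiscShallow` (stmt-BirchSwinnertonDyer-25504) — cdisprove g0 (KERNEL REFUTER, no kit): findings

**BSD is not proved or disproved for any curve by this file.  Nothing is refuted, no item is closed, the registered stubs are untouched.**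

TARGET (LEAD-BRIEF-g22 §1–2; PICKED «genus_supply_pos_shallow» v2, commit 38ae21c508e7): the registered stub
C⁺‴ = `GenusSupplyPos.stub_genusPrimitivityAtTwoPos`, attacked through its kernel **K₄⁺** = the binder `hK4` of
`Theorems.GenusSupplyPos.stubC_posDisc_of_selmerSplit` (p762235: C⁺‴ ⟸ K₁⁺ ∧ K₄⁺; K₁⁺ is LOSSLESS, p763825, NOT attacked — it even says the
`#Sel₂(E)=1` cell is EMPTY, cf. `DepthZeroSilent.frame_empty_of_reductionBitPos`).  `K4Pos` below is that binder verbatim.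
Companion file: `Cruxes/GenusDeepSupplyAtTwoNegDiscNarrow/Disproof.lean` (twin 23491, K₄) — its module docstring §1–§4 (Gross Question 11,
BSD-consistency, Gross 6.2 at deep primes, hypothesis census) applies here word for word except where this file says otherwise.

## VERDICT — stub-false sweep on C⁺‴ / K₄⁺: **no witness found** (1 target, 0 broken; no repair needed); ONE census flag (§2) for the LEAD

### 1. What K₄⁺ says
Frame as for K₄ with `0 < Δ_E`, the Selmer cell `#Sel₂(E/ℚ) = 4 ∧ ∃ c ∈ Sel₂(E/ℚ), loc_∞ c ≠ 0`, an ALL-SILENT twin (`ord₂ C(E^{(d_K)}) = 0`),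
`M₀ ≥ 1`.  Conclusion: some square-free `n`, all of whose primes are Zhang–Kolyvagin primes at `2` of index `≥ 2` (`4 ∣ ℓ+1`, `4 ∣ a_ℓ`,
`deepPrime_shape`) whose Frobenius MOVES a point of `E[2]`, carries a datum with `P(n) ∉ 2E(K[n])`.  Since `2 ∣ a_ℓ` makes `Frob_ℓ` unipotent on
`E[2]` (char. poly `≡ (X+1)²`), «moves a point of `E[2]`» = «is a transposition on `E[2]`» = «`Ẽ(𝔽_ℓ)[2] ≅ ℤ/2`» (the LEAD's cyclic-reduction
design).  Well-posedness as for K₄: `E(K[n])[2] = 0` (here `ℚ(√Δ)` is real, so the dihedral lemma needs nothing), hence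
`P(n) ∉ 2E(K[n]) ⟺ c₁(n) ≠ 0`.

### 2. CENSUS FLAG (not a defect): K₄⁺'s primes are OFF the classical Kolyvagin map
For `Δ > 0` complex conjugation `τ` is the IDENTITY on `E[2]` (`E[2] ⊂ E(ℝ)`) and `τ|E[4] ∼ diag(1, −1)` (`E(ℝ)[4] ≅ ℤ/4 × ℤ/2`).  A K₄⁺ prime
has `Frob_ℓ|E[4]` in the swap class `S` (the four lifts `S + 2(e·I + f·S)` of a transposition with `tr ≡ 0`, `det ≡ −1 (mod 4)` are conjugate
under `I + 2M₂(ℤ/4)`), and `S ≁ diag(1,−1)` (fixed groups `ℤ/4` vs `ℤ/4 × ℤ/2`).  Hence **no K₄⁺ prime is a Kolyvagin prime in the Frobenius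
sense (`Frob_ℓ ∼ τ` in `Gal(K(E[2^M])/ℚ)`) at ANY level `M`**; they are Kolyvagin primes only in the CONGRUENCE sense of Zhang 2014 /
Burungale–Castella–Grossi–Skinner («`ℓ` inert, `(ℓ, Np) = 1`, `M(ℓ) = min{ord_p(ℓ+1), ord_p(a_ℓ)} > 0`», tree `Zhang2014.IsKolyvaginPrime`),
a notion that coincides with the Frobenius one for odd `p` (eigenvalues `±1` distinct) and is strictly wider at `p = 2`.  By contrast the twin K₄
(Δ<0, `FrobEqFrobInfty`) uses EXACTLY the classical level-2 primes.  Consequences: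
* K₄⁺ is «Kolyvagin's conjecture `𝓜_∞ = 0` at `p = 2` in the literal Zhang/BCGS currency, restricted to swap-type `n`».  The heuristic
  «BSD ∧ Kolyvagin's structure theorem at 2 ⟹ `𝓜_∞ = 0`» is an argument about Frobenius-type primes (Chebotarev control of localisations of
  Selmer classes, Gross §8–9); it does NOT transfer to swap-type `n` as it stands.  So, unlike K₄, K₄⁺ is not backed by a printed or standard
  prediction — nor contradicted by one: the derived points `P(n)` exist (Gross Prop. 3.7 needs only `ℓ` inert, `ℓ ∤ N d_K`), `[P(n)] mod 2` is
  `𝒢_n`-fixed (`2 ∣ ℓ+1, a_ℓ`), `c₁(n) ∈ H¹(K, E[2])` is well defined, and Gross's Prop. 6.2 computation at a swap prime is IDENTICAL to the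
  Δ<0 one (`C^± = ker(Frob_ℓ ∓ 1)[2^∞] ⊂ Ẽ(𝔽_{ℓ²})` cyclic because `Ẽ(𝔽_ℓ)[2] ≅ ℤ/2`; `Q̃_ℓ = −2(μ+α)·y₂`, `y₂ ∈ C⁻`): on the `M₀ ≥ 1` cell
  every `d(ℓ)_λ = 0`, the classes `c₁(ℓ)` are Selmer, nothing forces them to vanish.  NO WITNESS, no mechanism for one.
* For the LEAD: the exactness side cannot quote Kolyvagin/McCallum structure statements for these `n` either; both supply AND the use of the
  supplied class are off-map at swap primes.  (The `FrobEqFrobInfty` currency is unavailable for Δ>0 at `M = 1` by design: it would force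
  `Frob_ℓ = 1` on `E[2]`, `Ẽ(𝔽_ℓ)[2] = E[2]`, and the reduction bit cannot be read on a non-cyclic `2`-Sylow.)

### 3. The archimedean Selmer clause (LEAD-BRIEF (iv)) — sound, not vacuous
`∃ c ∈ Sel₂(E/ℚ), loc_∞ c ≠ 0` with `loc_∞ : Sel₂ → H¹(ℝ, E[2]) = Hom(ℤ/2, (ℤ/2)²)` (`τ` trivial on `E[2]`): a Selmer class maps into the Kummer
line `E(ℝ)/2E(ℝ) ≅ ℤ/2` (two real components), and a `2`-covering whose real points cover the non-identity component gives `loc_∞ ≠ 0`; on the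
`r = 0`, `Ш[2] = (ℤ/2)²` cell both values occur in nature.  The clause CUTS the cell (it is the Δ>0 replacement of the depth-zero reduction bit,
`GenusPrimitiveSupplyAtTwoPosDiscShallowArchimedeanBit*`); it is satisfiable and not implied by the rest.  No typing defect found
(`galoisCohomology.localization … (Sum.inl Rat.infinitePlace) 1 c` is the tree's `loc_∞` at `H¹`).

### 4. Hypothesis census — as in the twin file §4, with: `hDEF : ord₂ C(Wd) = 0` (all-silent twin) and the archimedean clause cut the cell
only; `hsq1` (`K ≠ ℚ(√−Δ)`, the imaginary quadratic subfield of `ℚ(E[4])` other than `ℚ(i)`) is what makes swap-type inert primes exist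
(Chebotarev in `K·ℚ(E[8])`, `equivariantChebotarevAtTwo_eigen_of_not_isSquare`); `hoptDt ∧ hc` jointly load-bearing by the doubling datum
`c ↦ 2c`; `hcm` redundant given `hρ`; `d_K ≠ −3` idle at `2`.

### 5. Kernel content (sorry-free): §1 level-one exclusion (`exists_two_smul_derivedPoint_of_conductor_one`, `level_ne_one_…`,
`primeFactors_nonempty_…`: a K₄⁺-witness has level `n ≠ 1` with a prime factor `ℓ ≡ 3 (mod 4)`); §2 `deepPrime_shape`, `deepPrime_mod_four`;
§3 `K4Pos` verbatim and `K4Pos_apply` (the witness repackaged with §1–§2).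

## HANDOFF (cdisprove g0 → next arm)
Landed under `Negative/`: nothing.  Sorried: nothing.  Next regimes if re-armed: (a) ask bsd-f1-data whether swap-type deep primes were in the
pen's 31 453-frame census at all (the ACCT tables were built for the reduction bit, i.e. exactly these primes — then a -data seat could try the
smallest `K[ℓ]` for one `P(ℓ) mod 2`); (b) literature on Kolyvagin systems at `p = 2` with non-`τ` Frobenius primes (none found: presearch
lines in NOTES.md); (c) doubling lemma modulo frame inhabitation on request.
-/

set_option autoImplicit false
set_option linter.dupNamespace false -- `Summit.<P>.<Sub>` repeats `BirchSwinnertonDyer` (D-0017)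

noncomputable section

open scoped Classical

namespace Summit.BirchSwinnertonDyer.BirchSwinnertonDyer.Cruxes.GenusPrimitiveSupplyAtTwoPosDiscShallow.Disproof

open WeierstrassCurve Literature.NumberTheory.EllipticCurves Literature.NumberTheory.EllipticCurves.ModularForms
open Summit.BirchSwinnertonDyer.BirchSwinnertonDyer.Theses.GenusKolyvaginAtTwo

variable {K : Type} [Field K] [NumberField K]

/-! ## §1 Level-one exclusion: no K₄⁺-witness at conductor `1` -/

/-- **Every conductor-`1` datum has `2`-divisible `P(1)` on a frame with `2^{M₀} ∣ P_{d₁}(1)`, `1 ≤ M₀`** (level-one rigidity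
`GenusExact.RelaxedCount.derivedPoint_eq_of_conductor_one`). [cite: GrossLMS1991, §4 (P_1 = y_K)] -/
theorem exists_two_smul_derivedPoint_of_conductor_one (W : WeierstrassCurve ℚ) [W.IsElliptic] {N : ℕ} [NeZero N]
    {Dt : ModularParametrizationData W N} {β : ℤ} {ι : K →+* ℂ} (d₁ d : KolyvaginHeegnerData Dt β ι 1) {M₀ : ℕ} (hM : 1 ≤ M₀)
    (hdiv : ∃ Q : (W.baseChange (ringClassField K ι 1)).toAffine.Point, ((2 ^ M₀ : ℕ) : ℤ) • Q = d₁.derivedPoint) :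
    ∃ Q : (W.baseChange (ringClassField K ι 1)).toAffine.Point, (2 : ℤ) • Q = d.derivedPoint := by
  obtain ⟨Q, hQ⟩ := hdiv
  refine ⟨((2 ^ (M₀ - 1) : ℕ) : ℤ) • Q, ?_⟩
  rw [Summit.BirchSwinnertonDyer.BirchSwinnertonDyer.Theorems.GenusExact.RelaxedCount.derivedPoint_eq_of_conductor_one W d₁ d,
    smul_smul, ← hQ]
  congr 1
  have h2 : 2 * 2 ^ (M₀ - 1) = 2 ^ M₀ := by
    rw [← pow_succ']
    congr 1
    omega
  exact_mod_cast h2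

/-- **A witness of K₄⁺'s conclusion lives at level `n ≠ 1`.** -/
theorem level_ne_one_of_not_exists_two_smul (W : WeierstrassCurve ℚ) [W.IsElliptic] {N : ℕ} [NeZero N]
    {Dt : ModularParametrizationData W N} {β : ℤ} {ι : K →+* ℂ} (d₁ : KolyvaginHeegnerData Dt β ι 1) {M₀ : ℕ} (hM : 1 ≤ M₀)
    (hdiv : ∃ Q : (W.baseChange (ringClassField K ι 1)).toAffine.Point, ((2 ^ M₀ : ℕ) : ℤ) • Q = d₁.derivedPoint)
    {n : ℕ} (d : KolyvaginHeegnerData Dt β ι n)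
    (hprim : ¬ ∃ Q : (W.baseChange (ringClassField K ι n)).toAffine.Point, (2 : ℤ) • Q = d.derivedPoint) : n ≠ 1 := by
  rintro rfl
  exact hprim (exists_two_smul_derivedPoint_of_conductor_one W d₁ d hM hdiv)

/-- **… hence (square-free) it has a prime factor.** -/
theorem primeFactors_nonempty_of_not_exists_two_smul (W : WeierstrassCurve ℚ) [W.IsElliptic] {N : ℕ} [NeZero N]
    {Dt : ModularParametrizationData W N} {β : ℤ} {ι : K →+* ℂ} (d₁ : KolyvaginHeegnerData Dt β ι 1) {M₀ : ℕ} (hM : 1 ≤ M₀)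
    (hdiv : ∃ Q : (W.baseChange (ringClassField K ι 1)).toAffine.Point, ((2 ^ M₀ : ℕ) : ℤ) • Q = d₁.derivedPoint)
    {n : ℕ} (hn : Squarefree n) (d : KolyvaginHeegnerData Dt β ι n)
    (hprim : ¬ ∃ Q : (W.baseChange (ringClassField K ι n)).toAffine.Point, (2 : ℤ) • Q = d.derivedPoint) :
    n.primeFactors.Nonempty := by
  have h1 : n ≠ 1 := level_ne_one_of_not_exists_two_smul W d₁ hM hdiv d hprim
  have h0 : n ≠ 0 := by
    rintro rfl
    exact not_squarefree_zero hn
  rw [Finset.nonempty_iff_ne_empty, Ne, Nat.primeFactors_eq_empty]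
  omega

/-! ## §2 The shape of a deep Kolyvagin prime at `2` -/

/-- **A deep Zhang–Kolyvagin prime at `2`** is a prime `ℓ ≠ 2`, `ℓ ∤ N`, `ℓ ∤ d_K`, with `4 ∣ ℓ + 1` and `4 ∣ a_ℓ`.
[cite: WZhang2014, Notations (xii)] [cite: GrossLMS1991, §3 (3.3)] -/
theorem deepPrime_shape (W : WeierstrassCurve ℚ) [W.IsElliptic] [W.IsGloballyMinimal] (N : ℕ) (K : Type) [Field K] [NumberField K]
    {ℓ : ℕ} (hK : Zhang2014.IsKolyvaginPrime N W K 2 ℓ) (hidx : 2 ≤ Zhang2014.kolyvaginIndex W 2 ℓ) :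
    ℓ.Prime ∧ ¬ ℓ ∣ N ∧ ¬ ((ℓ : ℤ) ∣ NumberField.discr K) ∧ ℓ ≠ 2 ∧ 4 ∣ ℓ + 1 ∧ (4 : ℤ) ∣ W.frobeniusTrace ℓ := by
  haveI : Fact (Nat.Prime 2) := ⟨Nat.prime_two⟩
  obtain ⟨h1, h2⟩ := (Zhang2014.le_kolyvaginIndex_iff (W := W) (p := 2) (M := 2) (ℓ := ℓ)).mp hidx
  refine ⟨hK.1, hK.2.1, hK.2.2.1, hK.2.2.2.1, ?_, ?_⟩
  · norm_num at h1
    exact h1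
  · norm_num at h2
    exact h2

/-- `ℓ ≡ 3 (mod 4)`, `ℓ ≥ 3`. -/
theorem deepPrime_mod_four (W : WeierstrassCurve ℚ) [W.IsElliptic] [W.IsGloballyMinimal] (N : ℕ) (K : Type) [Field K] [NumberField K]
    {ℓ : ℕ} (hK : Zhang2014.IsKolyvaginPrime N W K 2 ℓ) (hidx : 2 ≤ Zhang2014.kolyvaginIndex W 2 ℓ) :
    ℓ % 4 = 3 ∧ 3 ≤ ℓ := by
  obtain ⟨hp, -, -, -, h4, -⟩ := deepPrime_shape W N K hK hidx
  have h2 := hp.two_le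
  omega

/-! ## §3 The target, verbatim -/

/-- **TARGET K₄⁺** = binder `hK4` of `GenusSupplyPos.stubC_posDisc_of_selmerSplit` (p762235), VERBATIM: deep `2`-primitive supply at
SWAP-TYPE primes on the `#Sel₂(E) = 4 ∧ loc_∞ ≠ 0` cell of the Δ>0 frame.  OPEN; off the classical Kolyvagin map (module docstring §2); no
witness against it (this file). [cite: GrossLMS1991, §11] [cite: WZhang2014, Notations (xii)] -/
def K4Pos : Prop :=
  ∀ (W : WeierstrassCurve ℚ) [W.IsElliptic] [W.IsGloballyMinimal] [NeZero (W.conductorNorm ℤ)],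
    ¬ W.HasCM → W.analyticRank = 0 → (∀ n : ℕ, 0 < n → W.HasSurjectiveModNGaloisRep ((2 : ℤ) ^ n)) →
    Odd W.tamagawaProduct → 0 < W.Δ →
    (Nat.card (W.selmerGroup 2) = 4 ∧ ∃ c ∈ (W.kummerSelmerStructure ((2 : ℕ) : ℤ)).selmerGroup,
      Literature.NumberTheory.GaloisRepresentations.galoisCohomology.localization (W.torsionGaloisModule ((2 : ℕ) : ℤ))
        (Sum.inl Rat.infinitePlace) 1 c ≠ 0) →
    ∀ (K : Type) [Field K] [NumberField K],
    IsImaginaryQuadratic K → Odd (NumberField.discr K) → NumberField.discr K ≠ -3 →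
    SatisfiesHeegnerHypothesis (W.conductorNorm ℤ) K →
    ¬ IsSquare ((NumberField.discr K : ℚ) * -|W.Δ|) → ¬ IsSquare ((NumberField.discr K : ℚ) * (-(2 * |W.Δ|))) →
    ∀ (Dt : ModularParametrizationData W (W.conductorNorm ℤ)),
    (∀ z ∈ Dt.L.lattice, ∃ w ∈ periodLattice Dt.f, z = (Dt.c : ℂ) * w) → Odd Dt.c →
    ∀ (β : ℤ) (ι : K →+* ℂ) (d₁ : KolyvaginHeegnerData Dt β ι 1), ¬ IsOfFinAddOrder d₁.derivedPoint →
    ∀ (M₀ : ℕ), (∃ Q : (W.baseChange (ringClassField K ι 1)).toAffine.Point, ((2 ^ M₀ : ℕ) : ℤ) • Q = d₁.derivedPoint) →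
    (¬ ∃ Q : (W.baseChange (ringClassField K ι 1)).toAffine.Point, ((2 ^ (M₀ + 1) : ℕ) : ℤ) • Q = d₁.derivedPoint) →
    1 ≤ M₀ →
    ∀ (Wd : WeierstrassCurve ℚ) [Wd.IsElliptic] [Wd.IsGloballyMinimal],
    (∃ C : WeierstrassCurve.VariableChange ℚ, C • W.quadraticTwist (NumberField.discr K : ℚ) = Wd) →
    Wd.analyticRank = 1 → Nat.card (Wd.selmerGroup 2) = 2 → padicValNat 2 Wd.tamagawaProduct = 0 →
    ∃ (n : ℕ) (d : KolyvaginHeegnerData Dt β ι n), Squarefree n ∧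
      (∀ ℓ ∈ n.primeFactors, Zhang2014.IsKolyvaginPrime (W.conductorNorm ℤ) W K 2 ℓ ∧ 2 ≤ Zhang2014.kolyvaginIndex W 2 ℓ ∧
        ∃ (v : IsDedekindDomain.HeightOneSpectrum (NumberField.RingOfIntegers ℚ))
          (𝔓 : Ideal (Literature.NumberTheory.GaloisRepresentations.absIntegers (NumberField.RingOfIntegers ℚ) ℚ))
          (h : Field.absoluteGaloisGroup ℚ), ((ℓ : ℕ) : NumberField.RingOfIntegers ℚ) ∈ v.asIdeal ∧ 𝔓 ∈ v.primesAbove ∧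
            IsArithFrobAt (NumberField.RingOfIntegers ℚ) h 𝔓 ∧ ∃ u : W.geomTorsion ((2 : ℕ) : ℤ), h • u ≠ u) ∧
      ¬ ∃ Q : (W.baseChange (ringClassField K ι n)).toAffine.Point, (2 : ℤ) • Q = d.derivedPoint

/-- **The K₄⁺-witness repackaged**: level `n ≠ 1` with a prime factor, every prime factor `≡ 3 (mod 4)` with `4 ∣ a_ℓ` and a Frobenius
moving `E[2]` (a transposition — swap class on `E[4]`). -/
theorem K4Pos_apply (hK4 : K4Pos) (W : WeierstrassCurve ℚ) [W.IsElliptic] [W.IsGloballyMinimal] [NeZero (W.conductorNorm ℤ)]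
    (hcm : ¬ W.HasCM) (hr0 : W.analyticRank = 0) (hρ : ∀ n : ℕ, 0 < n → W.HasSurjectiveModNGaloisRep ((2 : ℤ) ^ n))
    (hT : Odd W.tamagawaProduct) (hpos : 0 < W.Δ)
    (h4 : Nat.card (W.selmerGroup 2) = 4 ∧ ∃ c ∈ (W.kummerSelmerStructure ((2 : ℕ) : ℤ)).selmerGroup,
      Literature.NumberTheory.GaloisRepresentations.galoisCohomology.localization (W.torsionGaloisModule ((2 : ℕ) : ℤ))
        (Sum.inl Rat.infinitePlace) 1 c ≠ 0)
    (K : Type) [Field K] [NumberField K] (hIQ : IsImaginaryQuadratic K) (hodd : Odd (NumberField.discr K))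
    (h3 : NumberField.discr K ≠ -3) (hHe : SatisfiesHeegnerHypothesis (W.conductorNorm ℤ) K)
    (hsq1 : ¬ IsSquare ((NumberField.discr K : ℚ) * -|W.Δ|)) (hsq2 : ¬ IsSquare ((NumberField.discr K : ℚ) * (-(2 * |W.Δ|))))
    (Dt : ModularParametrizationData W (W.conductorNorm ℤ))
    (hoptDt : ∀ z ∈ Dt.L.lattice, ∃ w ∈ periodLattice Dt.f, z = (Dt.c : ℂ) * w) (hc : Odd Dt.c)
    (β : ℤ) (ι : K →+* ℂ) (d₁ : KolyvaginHeegnerData Dt β ι 1) (hy : ¬ IsOfFinAddOrder d₁.derivedPoint)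
    (M₀ : ℕ) (hdiv : ∃ Q : (W.baseChange (ringClassField K ι 1)).toAffine.Point, ((2 ^ M₀ : ℕ) : ℤ) • Q = d₁.derivedPoint)
    (hndiv : ¬ ∃ Q : (W.baseChange (ringClassField K ι 1)).toAffine.Point, ((2 ^ (M₀ + 1) : ℕ) : ℤ) • Q = d₁.derivedPoint)
    (hM : 1 ≤ M₀) (Wd : WeierstrassCurve ℚ) [Wd.IsElliptic] [Wd.IsGloballyMinimal]
    (hWd : ∃ C : WeierstrassCurve.VariableChange ℚ, C • W.quadraticTwist (NumberField.discr K : ℚ) = Wd)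
    (hrd : Wd.analyticRank = 1) (hSel : Nat.card (Wd.selmerGroup 2) = 2) (hDEF : padicValNat 2 Wd.tamagawaProduct = 0) :
    ∃ (n : ℕ) (d : KolyvaginHeegnerData Dt β ι n), Squarefree n ∧ n.primeFactors.Nonempty ∧
      (∀ ℓ ∈ n.primeFactors, ℓ % 4 = 3 ∧ (4 : ℤ) ∣ W.frobeniusTrace ℓ ∧
        ∃ (v : IsDedekindDomain.HeightOneSpectrum (NumberField.RingOfIntegers ℚ))
          (𝔓 : Ideal (Literature.NumberTheory.GaloisRepresentations.absIntegers (NumberField.RingOfIntegers ℚ) ℚ))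
          (h : Field.absoluteGaloisGroup ℚ), ((ℓ : ℕ) : NumberField.RingOfIntegers ℚ) ∈ v.asIdeal ∧ 𝔓 ∈ v.primesAbove ∧
            IsArithFrobAt (NumberField.RingOfIntegers ℚ) h 𝔓 ∧ ∃ u : W.geomTorsion ((2 : ℕ) : ℤ), h • u ≠ u) ∧
      ¬ ∃ Q : (W.baseChange (ringClassField K ι n)).toAffine.Point, (2 : ℤ) • Q = d.derivedPoint := by
  obtain ⟨n, d, hn, hℓ, hprim⟩ :=
    hK4 W hcm hr0 hρ hT hpos h4 K hIQ hodd h3 hHe hsq1 hsq2 Dt hoptDt hc β ι d₁ hy M₀ hdiv hndiv hM Wd hWd hrd hSel hDEF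
  refine ⟨n, d, hn, primeFactors_nonempty_of_not_exists_two_smul W d₁ hM hdiv hn d hprim, fun ℓ hℓn ↦ ?_, hprim⟩
  obtain ⟨hKℓ, hidx, hF⟩ := hℓ ℓ hℓn
  exact ⟨(deepPrime_mod_four W _ K hKℓ hidx).1, (deepPrime_shape W _ K hKℓ hidx).2.2.2.2.2, hF⟩

end Summit.BirchSwinnertonDyer.BirchSwinnertonDyer.Cruxes.GenusPrimitiveSupplyAtTwoPosDiscShallow.Disproof

end
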